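import Mathlib
import Literature.Analysis.FluidPDE.Tao2016AveragedNS.RenormalisedCascadeWaves
import Literature.Analysis.FluidPDE.Tao2016AveragedNS.SelfSimilarCascadeBlowup
import Literature.Analysis.FluidPDE.Tao2016AveragedNS.ViscousEternalSolutions
import Literature.Analysis.FluidPDE.Tao2016AveragedNS.BoundedEternalSolutions
import Summits.NavierStokesRegularity.NavierStokesRegularity.Theses.TaoLadderRungTwoBreak
import Summits.NavierStokesRegularity.NavierStokesRegularity.Theorems.TaoLadderRungTwoBreakNoSurvivingEternalViscBddOneClassicalForm
import Summits.NavierStokesRegularity.NavierStokesRegularity.Theorems.WakeRatchetAdmissibleEternalBoundCritical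
import Summits.NavierStokesRegularity.NavierStokesRegularity.Theorems.WakeRatchetAdmissibleEternalBoundTerminal

/-!
# Crux `TaoLadderRungTwoBreak.NoSurvivingEternalViscBddOne` (stmt-NavierStokesRegularity-20419):
# the SPLIT CHILDREN (ρ0) `NoSurvivingEternalBddOne` and (ρ+) `NoLoudLadderOne` IN CLASSICAL FORM (exact, by name)

MODEL lattice ODEs only (Tao 2016 §4, §6.4); nothing in this file is a statement about the Navier–Stokes
equations, and no stub, crux, rung or summit is proved by it.

Companion of `…ClassicalForm` (the crux itself).  In the critical variables `V_n(t) = (-t)⁻¹ W_n(-log(-t))` of that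
file (autonomous lattice (crit), type-I bound, uniformly integrable shells, shells bounded near `0⁻`, survival (surv)):

* `noSurvivingEternalBdd_iff_classical` — (ρ0)'s predicate `NoSurvivingEternalBdd R a` ⟺ the classical statement with
  `ν̂ = 0` (INVISCID autonomous lattice `V̇_n = Q(V_n) + ΛA(V_{n-1}) + Λ⁻¹B(V_{n+1},V_n)`); BY NAME
  `noSurvivingEternalBddOne_iff_classical`;
* `noLoudLadder_iff_classical` — (ρ+)'s predicate `NoLoudLadder R` ⟺ «below a threshold, for every E₂(R) table and
  every `ν̂ > 0`, no type-I solution of the viscous autonomous lattice with uniformly integrable shells, shells bounded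
  near `0⁻` and EVERY SHELL `n ≥ 0` LOUD (`sup_t physWeight(1)^n ‖V_n(t)‖² ≥ ν̂²/4096`) satisfies (surv) at `a = 1`»;
  BY NAME `noLoudLadderOne_iff_classical`.

With `…ClassicalForm` every registered Liouville statement of the crux (K1ᵛ(1), (ρ0), (ρ+)) now has an exact
restatement as a Liouville problem for type-I ancient solutions of Tao's autonomous cascade lattice, free of the
cell's renormalised vocabulary.

HONEST LABEL: dictionary work; the statements are the same open problems; crux ⟨20419⟩, its children and every NS
statement remain OPEN.
-/

noncomputable section

-- the summit and its single sub-problem share the name (CONVENTIONS §1)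
set_option linter.dupNamespace false

namespace Summit.NavierStokesRegularity.NavierStokesRegularity.Theorems.NoSurvivingEternalViscBddOne.ClassicalForm

open Filter Topology Set MeasureTheory
open Literature.Analysis.FluidPDE Literature.Analysis.FluidPDE.TaoCascade
open Summit.NavierStokesRegularity.NavierStokesRegularity.Theses.TaoLadderRungTwoBreak
open Summit.NavierStokesRegularity.NavierStokesRegularity.Theorems.WakeRatchetCritical (hasDerivAt_crit)
open Summit.NavierStokesRegularity.NavierStokesRegularity.Theorems.WakeRatchetTerminal
  (hasDerivAt_crit_visc exists_norm_crit_le)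

variable {m : ℕ} {ε₀ νh a : ℝ} {α : Fin m → Fin m → Fin m → ℤ × ℤ × ℤ → ℝ}

/-! ## Survival and loudness across the dictionary -/

/-- The critical variable at `t = 0 − e^{-σ}` of the embedded solution is `V` itself, and `‖V_n(t)‖² = e^{2σ}‖W_n(σ)‖²`
for the critical variable of any `W` at `t = -e^{-σ}`. Two rewriting identities. [elementary] -/
theorem norm_crit_sq_eq (W : ℤ → ℝ → Em m) (n : ℤ) (σ : ℝ) :
    ‖(- -Real.exp (-σ))⁻¹ • W n (-Real.log (- -Real.exp (-σ)))‖ ^ 2 = Real.exp (2 * σ) * ‖W n σ‖ ^ 2 := by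
  rw [neg_neg, Real.log_exp, neg_neg, ← Real.exp_neg, neg_neg, norm_smul, Real.norm_eq_abs,
    abs_of_pos (Real.exp_pos _), mul_pow, ← Real.exp_nat_mul]
  push_cast
  ring_nf

/-- (surv) for the critical variable of `W` from forward survival of `W`.
[cite: Tao2016AveragedNS, §4 Thm. 4.2 (statement shape), §6.4; cell vocabulary (`EternalSurvivingFwd`)] -/
theorem crit_surv_of_survivingFwd {W : ℤ → ℝ → Em m} (hS : EternalSurvivingFwd a ε₀ W) :
    ∃ c : ℝ, 0 < c ∧ ∀ N : ℕ, ∃ n : ℕ, N ≤ n ∧ ∃ t : ℝ, -Real.exp (-(N : ℝ)) ≤ t ∧ t < 0 ∧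
      c ≤ physWeight a ε₀ ^ n * ‖(-t)⁻¹ • W n (-Real.log (-t))‖ ^ 2 := by
  obtain ⟨c, hc, Hs⟩ := hS
  refine ⟨c, hc, fun N => ?_⟩
  obtain ⟨n, hn, σ, hσ, hle⟩ := Hs N
  refine ⟨n, hn, -Real.exp (-σ), ?_, neg_neg_iff_pos.2 (Real.exp_pos _), ?_⟩
  · have : Real.exp (-σ) ≤ Real.exp (-(N : ℝ)) := Real.exp_le_exp.2 (by linarith)
    linarith
  · rw [norm_crit_sq_eq]
    exact hle

/-- Loudness of a shell across the dictionary (`W`-side ⇒ `V`-side): `wtEnergy ε₀ W n σ = physWeight(1)^n ‖V_n(t)‖²`.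
[cite: Tao2016AveragedNS, §4 Thm. 4.2 (statement shape), §6.4; cell vocabulary (`wtEnergy`)] -/
theorem crit_loud_of_loud {W : ℤ → ℝ → Em m} {n : ℕ} {s₀ : ℝ} (h : ∃ σ : ℝ, s₀ < wtEnergy ε₀ W n σ) :
    ∃ t : ℝ, t < 0 ∧ s₀ < physWeight 1 ε₀ ^ n * ‖(-t)⁻¹ • W n (-Real.log (-t))‖ ^ 2 := by
  obtain ⟨σ, hσ⟩ := h
  refine ⟨-Real.exp (-σ), neg_neg_iff_pos.2 (Real.exp_pos _), ?_⟩
  rw [norm_crit_sq_eq]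
  exact hσ

/-- Loudness across the dictionary (`V`-side ⇒ `W`-side) for the embedded solution `W_n(σ) = e^{-σ} • V_n(0 − e^{-σ})`.
[cite: Tao2016AveragedNS, §4 Thm. 4.2 (statement shape), §6.4; cell vocabulary (`wtEnergy`)] -/
theorem loud_embed_of_crit_loud {V : ℤ → ℝ → Em m} {n : ℕ} {s₀ : ℝ}
    (h : ∃ t : ℝ, t < 0 ∧ s₀ < physWeight 1 ε₀ ^ n * ‖V n t‖ ^ 2) :
    ∃ σ : ℝ, s₀ < wtEnergy ε₀ (fun k σ => Real.exp (-σ) • V k (0 - Real.exp (-σ))) n σ := by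
  obtain ⟨t, ht, hs⟩ := h
  have hnt : 0 < -t := neg_pos.2 ht
  refine ⟨-Real.log (-t), ?_⟩
  unfold wtEnergy
  have hkey : Real.exp (2 * -Real.log (-t)) *
      ‖Real.exp (- -Real.log (-t)) • V (n : ℤ) (0 - Real.exp (- -Real.log (-t)))‖ ^ 2 = ‖V n t‖ ^ 2 := by
    rw [neg_neg, Real.exp_log hnt, norm_smul, Real.norm_eq_abs, abs_of_pos hnt, mul_pow, ← mul_assoc,
      show (0 : ℝ) - -t = t by ring,
      show Real.exp (2 * -Real.log (-t)) * (-t) ^ 2 = 1 by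
        rw [← Real.exp_log hnt, ← Real.exp_nat_mul, ← Real.exp_add, Real.log_exp]
        have : (2 : ℝ) * -Real.log (-t) + ((2 : ℕ) : ℝ) * Real.log (-t) = 0 := by push_cast; ring
        rw [this, Real.exp_zero], one_mul]
  rw [hkey]
  exact hs

/-! ## (ρ0): the bounded inviscid Liouville predicate in classical form -/

/-- **`NoSurvivingEternalBdd R a` IN CLASSICAL FORM (exact)** — the `ν̂ = 0` case: below a threshold, for every E₂(R)
table, no solution of the INVISCID autonomous lattice `V̇_n = Q(V_n) + ΛA(V_{n-1}) + Λ⁻¹B(V_{n+1},V_n)` on `t < 0` with the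
type-I bound, uniformly integrable shells and shells bounded near `0⁻` satisfies (surv).
[cite: Tao2016AveragedNS, §4 Thm. 4.2 (statement shape), Lemma 4.1 (4.8), §6.4; this file and `…ClassicalForm`] -/
theorem noSurvivingEternalBdd_iff_classical (R a : ℝ) :
    NoSurvivingEternalBdd R a ↔
    ∃ εs : ℝ, 0 < εs ∧ ∀ ε₀ : ℝ, 0 < ε₀ → ε₀ ≤ εs →
      ∀ α : Fin 4 → Fin 4 → Fin 4 → ℤ × ℤ × ℤ → ℝ, InTableClass R α →
        ∀ V : ℤ → ℝ → Em 4,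
          (∀ (n : ℤ) (t : ℝ), t < 0 → HasDerivAt (V n)
            (tableQ α (V n t) + bigLam ε₀ • tableA α (V (n - 1) t)
              + (bigLam ε₀)⁻¹ • tableB α (V (n + 1) t) (V n t)) t) →
          (∃ C : ℝ, ∀ (n : ℤ) (t : ℝ), t < 0 → ‖V n t‖ ≤ C / (-t)) →
          (∃ M : ℝ, ∀ n : ℤ, IntegrableOn (fun t => ‖V n t‖) (Iio 0) ∧ ∫ t in Iio 0, ‖V n t‖ ≤ M) →
          (∀ n : ℤ, ∃ t₀ : ℝ, t₀ < 0 ∧ ∃ P : ℝ, ∀ t : ℝ, t₀ ≤ t → t < 0 → ‖V n t‖ ≤ P) →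
            ¬ ∃ c : ℝ, 0 < c ∧ ∀ N : ℕ, ∃ n : ℕ, N ≤ n ∧ ∃ t : ℝ, -Real.exp (-(N : ℝ)) ≤ t ∧ t < 0 ∧
                c ≤ physWeight a ε₀ ^ n * ‖V n t‖ ^ 2 := by
  constructor
  · rintro ⟨εs, hεs, H⟩
    refine ⟨εs, hεs, fun ε₀ hε₀ hle α hα V hV hC hact hbd hsurv => ?_⟩
    obtain ⟨C, hC⟩ := hC
    have hV' : ∀ (n : ℤ) (t : ℝ), t < 0 → HasDerivAt (V n)
        (tableQ α (V n t) + bigLam ε₀ • tableA α (V (n - 1) t)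
          + (bigLam ε₀)⁻¹ • tableB α (V (n + 1) t) (V n t)
          - ((0 : ℝ) * (1 + ε₀) ^ ((2 : ℝ) * n)) • V n t) t :=
      fun n t ht => (hV n t ht).congr_deriv (by rw [zero_mul, zero_smul, sub_zero])
    have hW := isEternalVisc_of_classical (ε₀ := ε₀) (α := α) le_rfl hV' hact hbd
    have hU := uniformBound_of_classical (V := V) hC
    refine H ε₀ hε₀ hle α hα _ (isEternalVisc_zero_iff.1 hW) hU (survivingFwd_of_crit (a := a) (ε₀ := ε₀) ?_)
    obtain ⟨c, hc, Hs⟩ := hsurv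
    refine ⟨c, hc, fun N => ?_⟩
    obtain ⟨n, hn, t, htN, ht, hle'⟩ := Hs N
    refine ⟨n, hn, t, htN, ht, ?_⟩
    have hnt : 0 < -t := neg_pos.2 ht
    have hid : (-t)⁻¹ • (Real.exp (-(-Real.log (-t))) • V (n : ℤ) (0 - Real.exp (-(-Real.log (-t)))))
        = V n t := by
      rw [neg_neg, Real.exp_log hnt, smul_smul, inv_mul_cancel₀ hnt.ne', one_smul]
      congr 1
      ring
    rw [hid]
    exact hle'
  · rintro ⟨εs, hεs, H⟩
    refine ⟨εs, hεs, fun ε₀ hε₀ hle α hα W hW hU hS => ?_⟩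
    exact H ε₀ hε₀ hle α hα (fun n t => (-t)⁻¹ • W n (-Real.log (-t)))
      (fun n t ht => hasDerivAt_crit ht (hW.law n _)) (crit_typeI hU) (crit_action hW.isEternalVisc)
      (fun n => exists_norm_crit_le hW.isEternalVisc n) (crit_surv_of_survivingFwd hS)

/-- **(ρ0) `NoSurvivingEternalBddOne` IN CLASSICAL FORM (by name, exact).**
[cite: Tao2016AveragedNS, §4 Thm. 4.2 (statement shape), §6.4; this file] -/
theorem noSurvivingEternalBddOne_iff_classical :
    NoSurvivingEternalBddOne ↔
    ∀ R : ℝ, 1 ≤ R → ∃ εs : ℝ, 0 < εs ∧ ∀ ε₀ : ℝ, 0 < ε₀ → ε₀ ≤ εs →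
      ∀ α : Fin 4 → Fin 4 → Fin 4 → ℤ × ℤ × ℤ → ℝ, InTableClass R α →
        ∀ V : ℤ → ℝ → Em 4,
          (∀ (n : ℤ) (t : ℝ), t < 0 → HasDerivAt (V n)
            (tableQ α (V n t) + bigLam ε₀ • tableA α (V (n - 1) t)
              + (bigLam ε₀)⁻¹ • tableB α (V (n + 1) t) (V n t)) t) →
          (∃ C : ℝ, ∀ (n : ℤ) (t : ℝ), t < 0 → ‖V n t‖ ≤ C / (-t)) →
          (∃ M : ℝ, ∀ n : ℤ, IntegrableOn (fun t => ‖V n t‖) (Iio 0) ∧ ∫ t in Iio 0, ‖V n t‖ ≤ M) →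
          (∀ n : ℤ, ∃ t₀ : ℝ, t₀ < 0 ∧ ∃ P : ℝ, ∀ t : ℝ, t₀ ≤ t → t < 0 → ‖V n t‖ ≤ P) →
            ¬ ∃ c : ℝ, 0 < c ∧ ∀ N : ℕ, ∃ n : ℕ, N ≤ n ∧ ∃ t : ℝ, -Real.exp (-(N : ℝ)) ≤ t ∧ t < 0 ∧
                c ≤ physWeight 1 ε₀ ^ n * ‖V n t‖ ^ 2 :=
  ⟨fun h R hR => (noSurvivingEternalBdd_iff_classical R 1).1 (h R hR),
    fun h R hR => (noSurvivingEternalBdd_iff_classical R 1).2 (h R hR)⟩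

/-! ## (ρ+): the loud-ladder exclusion in classical form -/

/-- **`NoLoudLadder R` IN CLASSICAL FORM (exact).**  Below a threshold, for every E₂(R) table and every `ν̂ > 0`, no
type-I solution of the viscous autonomous lattice on `t < 0` with uniformly integrable shells, shells bounded near `0⁻`
and every shell `n ≥ 0` loud (`sup_t physWeight(1)^n ‖V_n(t)‖² ≥ ν̂²/4096`) satisfies (surv) at `a = 1`.
[cite: Tao2016AveragedNS, §4 Thm. 4.2 (statement shape) and the viscous equation before it, §6.4; this file] -/
theorem noLoudLadder_iff_classical (R : ℝ) :
    NoLoudLadder R ↔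
    ∃ εs : ℝ, 0 < εs ∧ ∀ ε₀ : ℝ, 0 < ε₀ → ε₀ ≤ εs →
      ∀ α : Fin 4 → Fin 4 → Fin 4 → ℤ × ℤ × ℤ → ℝ, InTableClass R α →
        ∀ νh : ℝ, 0 < νh → ∀ V : ℤ → ℝ → Em 4,
          (∀ (n : ℤ) (t : ℝ), t < 0 → HasDerivAt (V n)
            (tableQ α (V n t) + bigLam ε₀ • tableA α (V (n - 1) t)
              + (bigLam ε₀)⁻¹ • tableB α (V (n + 1) t) (V n t)
              - (νh * (1 + ε₀) ^ ((2 : ℝ) * n)) • V n t) t) →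
          (∃ C : ℝ, ∀ (n : ℤ) (t : ℝ), t < 0 → ‖V n t‖ ≤ C / (-t)) →
          (∃ M : ℝ, ∀ n : ℤ, IntegrableOn (fun t => ‖V n t‖) (Iio 0) ∧ ∫ t in Iio 0, ‖V n t‖ ≤ M) →
          (∀ n : ℤ, ∃ t₀ : ℝ, t₀ < 0 ∧ ∃ P : ℝ, ∀ t : ℝ, t₀ ≤ t → t < 0 → ‖V n t‖ ≤ P) →
          (∀ (n : ℕ) (s₀ : ℝ), s₀ < νh ^ 2 / 4096 → ∃ t : ℝ, t < 0 ∧ s₀ < physWeight 1 ε₀ ^ n * ‖V n t‖ ^ 2) →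
            ¬ ∃ c : ℝ, 0 < c ∧ ∀ N : ℕ, ∃ n : ℕ, N ≤ n ∧ ∃ t : ℝ, -Real.exp (-(N : ℝ)) ≤ t ∧ t < 0 ∧
                c ≤ physWeight 1 ε₀ ^ n * ‖V n t‖ ^ 2 := by
  constructor
  · rintro ⟨εs, hεs, H⟩
    refine ⟨εs, hεs, fun ε₀ hε₀ hle α hα νh hν V hV hC hact hbd hloud hsurv => ?_⟩
    obtain ⟨C, hC⟩ := hC
    have hW := isEternalVisc_of_classical (ε₀ := ε₀) (α := α) hν.le hV hact hbd
    have hU := uniformBound_of_classical (V := V) hC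
    refine H ε₀ hε₀ hle α hα νh _ hν hW hU (fun n₀ s₀ hs => loud_embed_of_crit_loud (hloud n₀ s₀ hs))
      (survivingFwd_of_crit (a := 1) (ε₀ := ε₀) ?_)
    obtain ⟨c, hc, Hs⟩ := hsurv
    refine ⟨c, hc, fun N => ?_⟩
    obtain ⟨n, hn, t, htN, ht, hle'⟩ := Hs N
    refine ⟨n, hn, t, htN, ht, ?_⟩
    have hnt : 0 < -t := neg_pos.2 ht
    have hid : (-t)⁻¹ • (Real.exp (-(-Real.log (-t))) • V (n : ℤ) (0 - Real.exp (-(-Real.log (-t)))))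
        = V n t := by
      rw [neg_neg, Real.exp_log hnt, smul_smul, inv_mul_cancel₀ hnt.ne', one_smul]
      congr 1
      ring
    rw [hid]
    exact hle'
  · rintro ⟨εs, hεs, H⟩
    refine ⟨εs, hεs, fun ε₀ hε₀ hle α hα νh W hν hW hU hloud hS => ?_⟩
    exact H ε₀ hε₀ hle α hα νh hν (fun n t => (-t)⁻¹ • W n (-Real.log (-t)))
      (fun n t ht => hasDerivAt_crit_visc ht (hW.law n _)) (crit_typeI hU) (crit_action hW)
      (fun n => exists_norm_crit_le hW n) (fun n s₀ hs => crit_loud_of_loud (hloud n s₀ hs))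
      (crit_surv_of_survivingFwd hS)

/-- **(ρ+) `NoLoudLadderOne` IN CLASSICAL FORM (by name, exact).**
[cite: Tao2016AveragedNS, §4 Thm. 4.2 (statement shape), §6.4; this file] -/
theorem noLoudLadderOne_iff_classical :
    NoLoudLadderOne ↔
    ∀ R : ℝ, 1 ≤ R → ∃ εs : ℝ, 0 < εs ∧ ∀ ε₀ : ℝ, 0 < ε₀ → ε₀ ≤ εs →
      ∀ α : Fin 4 → Fin 4 → Fin 4 → ℤ × ℤ × ℤ → ℝ, InTableClass R α →
        ∀ νh : ℝ, 0 < νh → ∀ V : ℤ → ℝ → Em 4,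
          (∀ (n : ℤ) (t : ℝ), t < 0 → HasDerivAt (V n)
            (tableQ α (V n t) + bigLam ε₀ • tableA α (V (n - 1) t)
              + (bigLam ε₀)⁻¹ • tableB α (V (n + 1) t) (V n t)
              - (νh * (1 + ε₀) ^ ((2 : ℝ) * n)) • V n t) t) →
          (∃ C : ℝ, ∀ (n : ℤ) (t : ℝ), t < 0 → ‖V n t‖ ≤ C / (-t)) →
          (∃ M : ℝ, ∀ n : ℤ, IntegrableOn (fun t => ‖V n t‖) (Iio 0) ∧ ∫ t in Iio 0, ‖V n t‖ ≤ M) →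
          (∀ n : ℤ, ∃ t₀ : ℝ, t₀ < 0 ∧ ∃ P : ℝ, ∀ t : ℝ, t₀ ≤ t → t < 0 → ‖V n t‖ ≤ P) →
          (∀ (n : ℕ) (s₀ : ℝ), s₀ < νh ^ 2 / 4096 → ∃ t : ℝ, t < 0 ∧ s₀ < physWeight 1 ε₀ ^ n * ‖V n t‖ ^ 2) →
            ¬ ∃ c : ℝ, 0 < c ∧ ∀ N : ℕ, ∃ n : ℕ, N ≤ n ∧ ∃ t : ℝ, -Real.exp (-(N : ℝ)) ≤ t ∧ t < 0 ∧
                c ≤ physWeight 1 ε₀ ^ n * ‖V n t‖ ^ 2 :=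
  ⟨fun h R hR => (noLoudLadder_iff_classical R).1 (h R hR),
    fun h R hR => (noLoudLadder_iff_classical R).2 (h R hR)⟩

end Summit.NavierStokesRegularity.NavierStokesRegularity.Theorems.NoSurvivingEternalViscBddOne.ClassicalForm

end
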